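import Mathlib.Tactic.Linarith
import Mathlib.Tactic.NormNum
import Mathlib.Tactic.Ring
import HarnessLib

/-!
# The (0,1) cell of the ι-window, XXXVII (companion C): the product ground `B₁ × B₂`, XXIV — THE CORNER IX, ADDENDUM 2
# (report [XXXVII] `H2-ZERO-ONE-37.md` §12): arithmetic shadows of THEOREM SOC-OFF and COROLLARY FIXED-SKELETON

Family `hodge`, b2b cell `hweil` (helper of item stmt-HodgeConjecture-2524). Report
`run/shared/lean/b2b/hodge-weil/b2b-hweil-pv1-g49/H2-ZERO-ONE-37.md` ([XXXVII]) §12 (ADDENDUM 2). Context (the report's words, nothing of them formalised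
here): the socle sections of `ω_{W′}(2S)` carried by the reduced components of `W′` OUTSIDE `S` ([XXXV] LEMMA SOC (a)) are not killed by `x̃²`, so they add
to the Ω-bound of [XXXVI]/[XXXVII]: `e₁^ι ≥ (MAIN + ½Δχ) + D + SOC⁺_off` (THEOREM SOC-OFF). A free ι-orbit of off-S components contributes
`h⁰(ω_C(2S)) ≥ p_a(C) − 1 + 2(C·S)`: `k² + 4k ≥ 5` for a B-horizontal curve of class `kθ₁`, `≥ α + 4β ≥ 6` for a bi-dominant curve of `H`, `2` for a
vertical fibre; an ι-fixed symmetric B-horizontal curve smooth at its fixed points contributes `½(k² + 4k) − φ/4` (`φ ≤ 16` fixed points): `1` for a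
symmetric theta divisor (`k = 1`, `φ = 6`), `≥ 2` for `k ≥ 2`. In the 63 type-1 residual cells whose Ω-bracket is non-negative in every configuration this
leaves no free off-S orbit and at most one theta-divisor horizontal (COROLLARY FIXED-SKELETON). The theorems below are the integer inequalities behind these
values. None of them claims geometry. HONEST FRAMING: census work inside the ladder's H2 test ((0,1) cell) on the SPECIAL fourfold `X₀`; nothing here is a
rung; no case of the Hodge conjecture is proved; no statement of [Markman 2025] / [Perry 2026] / [EdGFS 2025] is used.
-/

-- mandated namespace `Summit.HodgeConjecture.HodgeConjecture.…` (Problem = Summit) trips `linter.dupNamespace`; the lakefile disables it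
-- tree-wide (weak option), restated here so stand-alone elaboration is warning-free too.
set_option linter.dupNamespace false

namespace Summit.HodgeConjecture.HodgeConjecture.WeilTypeLadder

section ProductGroundTwentyFourC

/-- **[XXXVII] 12.1 (THEOREM SOC-OFF, the free-orbit values).** A B-horizontal curve `Γ̄ × {c}` with `Γ̄ ≡ kθ₁` has `p_a = k² + 1` and `C·S = 2k`, so
`χ(ω_C(2S)) = p_a − 1 + 2(C·S) = k² + 4k ≥ 5` for `k ≥ 1`; a bi-dominant curve of `H` of class `(α, β)`, `α ≥ 2`, `β ≥ 1`, has `p_a ≥ α + 1`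
(Riemann–Hurwitz over `C₂`), so `p_a − 1 + 4β ≥ α + 4β ≥ 6`; a vertical fibre off `S` gives `h⁰(K₂) = 2`. Each is `≥ 2`. [`nlinarith`, `omega`] -/
theorem pg24c_soc_off_free :
    (∀ k : ℤ, 1 ≤ k → 5 ≤ k ^ 2 + 4 * k ∧ (k ^ 2 + 1) - 1 + 2 * (2 * k) = k ^ 2 + 4 * k) ∧
    (∀ α β p : ℤ, 2 ≤ α → 1 ≤ β → α + 1 ≤ p → 6 ≤ p - 1 + 4 * β) ∧ ((2 : ℤ) - 1 + 0 + 1 = 2) := by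
  refine ⟨?_, fun α β p hα hβ hp => by omega, by norm_num⟩
  intro k hk
  constructor
  · nlinarith
  · ring

/-- **[XXXVII] 12.1 (THEOREM SOC-OFF, the fixed values).** An ι-fixed symmetric B-horizontal curve of class `kθ₁`, smooth at its `φ ≤ 16` fixed points,
contributes `h⁰(ω_C(2S))⁺ ≥ ½(k² + 4k) − φ/4`, i.e. `4h⁰⁺ ≥ 2(k² + 4k) − φ`: for `k ≥ 2` this is `≥ 8` (so `h⁰⁺ ≥ 2`); for `k = 1`, `φ = 6` (a symmetric
theta divisor of the genus-2 Jacobian passes through six 2-torsion points) it is `4`, i.e. `h⁰⁺ = 1` exactly since `h¹ = 0`. [`nlinarith`, `norm_num`] -/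
theorem pg24c_soc_off_fixed :
    (∀ k φ : ℤ, 2 ≤ k → φ ≤ 16 → 8 ≤ 2 * (k ^ 2 + 4 * k) - φ) ∧ ((2 : ℤ) * (1 ^ 2 + 4 * 1) - 6 = 4 ∧ (4 : ℤ) / 4 = 1) := by
  refine ⟨?_, by norm_num⟩
  intro k φ hk hφ
  nlinarith

/-- **[XXXVII] 12.2 (COROLLARY FIXED-SKELETON, the brackets).** The Ω-bracket `MAIN + ½Δχ` of the LEDGER is non-negative in every configuration of: the
45 cells `(7, d₃ ≥ 4, 21, a₂)` (`(d₃ − 3)(14 − P)`, `P ≤ 14`), the 17 cells `(7, 3, a₁, a₂)` (`0`), and `(8, 3, 19, 15)` (`2(24 − P_h)`, `P_h ≤ 24`);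
in `(8,3,19,16)` / `(9,3,19,16)` it can be `−4` (`48 − 2·26`, `100 − 4·26`). With bracket `≥ 0` and every socle term `≥ 2` per free orbit, a (0,1)
object (`e₁^ι = 1`) has none: `0 + 2n ≤ 1 ⟹ n = 0`. [`omega`] -/
theorem pg24c_brackets :
    (∀ d₃ P : ℕ, 3 ≤ d₃ → P ≤ 14 → 0 ≤ (d₃ - 3) * (14 - P)) ∧ (∀ P : ℕ, P ≤ 24 → 0 ≤ 2 * (24 - P)) ∧
    ((48 : ℤ) - 2 * 26 = -4 ∧ (100 : ℤ) - 4 * 26 = -4) ∧ (∀ b n : ℕ, b + 2 * n ≤ 1 → n = 0) := by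
  refine ⟨fun d₃ P _ _ => Nat.zero_le _, fun P _ => Nat.zero_le _, by norm_num, fun b n h => by omega⟩

end ProductGroundTwentyFourC

end Summit.HodgeConjecture.HodgeConjecture.WeilTypeLadder
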